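import Literature.Analysis.FluidPDE.TorusTwoBackgroundGevreyBalance
import Literature.Analysis.FluidPDE.TorusTwoBackgroundH1Balance
import Literature.Analysis.FluidPDE.TorusNSGevreyBootstrap
import Literature.Analysis.FunctionSpaces.TorusClassicalNSGluing
import HarnessLib

/-!
# Gevrey-class smoothing of the two-background linearised Navier–Stokes flow on `T^d`

Analysis/FluidPDE proof file (theorems only; no definitions, no named facts), the TWO-BACKGROUND
twin of `TorusLinearisedNSGevreySmoothing` (the linear Foias–Temam Gevrey-class smoothing
estimate, J. Funct. Anal. 87 (1989), Thm 1.1, periodic case, along a uniformly Gevrey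
background). Main theorem `Torus.twoBackground_gevrey_of_gevreyBound`: for `ν > 0`, a Gevrey
radius `σ₀ > 0` and level `C₀` and a window length `τ > 0` there are `σ > 0` and `C` such that for
EVERY pair of jointly smooth divergence-free backgrounds `u₁, u₂` on `[a, a + τ] × T^d` with
`∑_{k ∈ S} e^{2σ₀|k|} ‖ûⱼ(t, k)‖² ≤ C₀` (all `t`, all finite `S`, `j = 1, 2`) and every jointly
smooth solution `(w, q)` of

`∂ₜw + (u₁·∇)w + (w·∇)u₂ = νΔw − ∇q`, `div w = 0`, `∫ w = 0`

(advection by `u₁`, stretching of `u₂`: the equation of the difference of two linearised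
solutions along two Gevrey trajectories, and of second variations),
`∑_{k ∈ S} e^{2σ|k|} ‖ŵ(a + τ, k)‖² ≤ C (∫ ‖w(a)‖² + ‖∇w(a)‖₂²)` for every finite `S`.

Steps (verbatim the one-background proof with the two-background inputs). (1) On
`[t₀, t₁] = [a + τ − σ, a + τ]` the differential inequality `Y_R' ≤ −(5/4)κ Z_R + K Y` of
`Torus.twoBackground_gevreyBalance_le`, `K = K(ν, σ₀, C₀, d)` (both backgrounds enter through
`NSGevrey.summable_exp_mul_one_add_sqrt_mul_norm_of_gevreyBound` at radius `σ₀/2 ≥ σ`, combined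
level `2A`), is LINEAR in `Y`; at any level `Y ≤ M` it has the two-level form of
`NSGevrey.gevrey_two_level_of_balance` with `G = K M`. (2) The bootstrap
`NSGevrey.le_of_two_level_bound` with `σ K ≤ 1/2` and the levels `M = 2y₀ + ε` gives
`Y(t₁) ≤ 2 y₀`, `y₀ = (4π²)⁻¹ e^{K'τ} (∫ ‖w(a)‖² + ‖∇w(a)‖₂²) ≥ Y(t₀)` by the exponential `H¹`
bound of the two-background flow `Torus.twoBackground_h1_le_mul_exp` (rate `K'` from the sup
bounds `‖u₁‖ ≤ B`, `‖∂ᵢu₂‖ ≤ B` under the Gevrey bound, `Torus.exists_sobolevBounds_of_gevreyBound`).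
(3) `N → ∞` on the finite `S`. Only `div u₁ = 0` is used (the transport term of the energy
identity); no incompressibility of `u₂` is needed.

## Mathlib / tree search

Tree (reused): `NSGevrey.gevrey_two_level_of_balance`, `NSGevrey.le_of_two_level_bound`,
`NSGevrey.summable_exp_sq_mul_freqNormSq_mul`, `NSGevrey.mFourierCoeff_complexify_zero_of_hasZeroMean`
(`TorusNSGevrey*`), `Torus.IsSmoothSpaceTimeOn.timeDerivWithin_eq_of_subset`
(`TorusClassicalNSGluing`), `Torus.exists_sobolevBounds_of_gevreyBound` (`TorusGevreySobolevBounds`).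
Searched `twoBackground`, `gevrey_of_gevreyBound`: only the one-background theorem
`Torus.linearisedNS_gevrey_of_gevreyBound` (`u₁ = u₂`).

Reference: C. Foias, R. Temam, *Gevrey class regularity for the solutions of the Navier–Stokes
equations*, J. Funct. Anal. 87 (1989) 359–369, Thm 1.1 and its proof (2.15)–(2.17), Lemma 2.1.
[FoiasTemam1989]
-/

noncomputable section

open MeasureTheory Set Filter UnitAddTorus Function Finset
open scoped Topology BigOperators InnerProductSpace

namespace Literature.Analysis.FluidPDE

namespace NSGevrey

open Literature.Analysis.FunctionSpaces Literature.Analysis.FunctionSpaces.Torus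

variable {d : Type*} [Fintype d] [DecidableEq d]

/-- **Gevrey-class smoothing of the two-background linearised Navier–Stokes flow along uniformly
Gevrey backgrounds** (the two-background linear twin of Foias–Temam 1989, Thm 1.1, periodic case,
a-priori form). On `T^d` let `ν > 0`, a Gevrey radius `σ₀ > 0` and level `C₀` of the backgrounds
and a window length `τ > 0` be given. There are `σ > 0` and `C` such that: for all jointly smooth
`u₁, u₂` on `[a, a + τ] × T^d`, `u₁` with divergence-free slices, with
`∑_{k ∈ S} e^{2σ₀|k|} ‖𝓕(complexify ∘ uⱼ t)(k)‖² ≤ C₀` for all `t ∈ [a, a + τ]`, all finite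
`S ⊆ ℤ^d` and `j = 1, 2`, and every jointly smooth `(w, q)` with `div w(t) = 0`, `∫ w(t) = 0` and
`∂ₜw + (u₁·∇)w + (w·∇)u₂ = νΔw − ∇q` pointwise (one-sided time derivative within `[a, a + τ]`),
the final slice of `w` is Gevrey with
`∑_{k ∈ S} e^{2σ|k|} ‖𝓕(complexify ∘ w (a + τ))(k)‖² ≤ C (∫ ‖w(a)‖² + ‖∇w(a)‖₂²)` for every finite `S`.
Proof: the linear Gevrey balance `Y_R' ≤ −(5/4)κ Z_R + K Y` on `[a + τ − σ, a + τ]`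
(`Torus.twoBackground_gevreyBalance_le`), the two-level integration
`NSGevrey.gevrey_two_level_of_balance`, the bootstrap `NSGevrey.le_of_two_level_bound` at the
levels `2y₀ + ε` (`σK ≤ 1/2`), and the exponential `H¹` bound `Torus.twoBackground_h1_le_mul_exp`
for `y₀`. [cite: FoiasTemam1989, Thm 1.1 and Lemma 2.1] -/
theorem _root_.Literature.Analysis.FluidPDE.Torus.twoBackground_gevrey_of_gevreyBound {ν : ℝ} (hν : 0 < ν)
    (σ₀ C₀ τ : ℝ) (hσ₀ : 0 < σ₀) (hτ : 0 < τ) :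
    ∃ σ : ℝ, 0 < σ ∧ ∃ C : ℝ, ∀ {a : ℝ} {u₁ u₂ w : ℝ → UnitAddTorus d → EuclideanSpace ℝ d}
      {q : ℝ → UnitAddTorus d → ℝ},
      IsSmoothSpaceTimeOn (Icc a (a + τ)) u₁ → (∀ t ∈ Icc a (a + τ), IsDivFree (u₁ t)) →
      IsSmoothSpaceTimeOn (Icc a (a + τ)) u₂ →
      (∀ t ∈ Icc a (a + τ), ∀ S : Finset (d → ℤ), ∑ k ∈ S, Real.exp (2 * σ₀ * Real.sqrt (freqNormSq k)) *
        ‖mFourierCoeff (EuclideanSpace.complexify ∘ u₁ t) k‖ ^ 2 ≤ C₀) →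
      (∀ t ∈ Icc a (a + τ), ∀ S : Finset (d → ℤ), ∑ k ∈ S, Real.exp (2 * σ₀ * Real.sqrt (freqNormSq k)) *
        ‖mFourierCoeff (EuclideanSpace.complexify ∘ u₂ t) k‖ ^ 2 ≤ C₀) →
      IsSmoothSpaceTimeOn (Icc a (a + τ)) w → IsSmoothSpaceTimeOn (Icc a (a + τ)) q →
      (∀ t ∈ Icc a (a + τ), IsDivFree (w t)) → (∀ t ∈ Icc a (a + τ), HasZeroMean (w t)) →
      (∀ t ∈ Icc a (a + τ), ∀ x, timeDerivWithin (Icc a (a + τ)) w t x + Torus.convect (u₁ t) (w t) x +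
        Torus.convect (w t) (u₂ t) x = ν • Torus.laplacian (w t) x - Torus.gradient (q t) x) →
      ∀ S : Finset (d → ℤ), ∑ k ∈ S, Real.exp (2 * σ * Real.sqrt (freqNormSq k)) *
        ‖mFourierCoeff (EuclideanSpace.complexify ∘ w (a + τ)) k‖ ^ 2 ≤
          C * ((∫ x, ‖w a x‖ ^ 2) + gradNormSq (w a)) := by
  -- adapted from `Torus.linearisedNS_gevrey_of_gevreyBound` (`TorusLinearisedNSGevreySmoothing`)
  -- constants from the Gevrey data of the backgrounds (all depend on `d, ν, σ₀, C₀, τ` only)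
  obtain ⟨B, hB⟩ := exists_sobolevBounds_of_gevreyBound (d := d) hσ₀ C₀
  set A : ℝ := 2 * Real.sqrt C₀ * ∑' m : d → ℤ, (1 + freqNormSq m) ^ 1 *
    Real.exp (-(σ₀ / 2 * Real.sqrt (freqNormSq m))) with hA
  set K : ℝ := (2 + 16 * (2 * Real.pi * (Fintype.card d : ℝ) ^ 2) ^ 2 * (2 * A) ^ 2) /
    (4 * Real.pi ^ 2 * ν) with hK
  have hK0 : 0 ≤ K := by positivity
  set K' : ℝ := 2 * ∑ _i : d, B + ((∑ _i : d, B) ^ 2 + (Fintype.card d) * B ^ 2) / ν with hK'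
  set L : ℝ := Real.exp (max K' 0 * τ) with hL
  set T₂ : ℝ := min τ (min (σ₀ / 2) (1 / (2 * K + 1))) with hT₂
  have hT₂0 : 0 < T₂ := lt_min hτ (lt_min (half_pos hσ₀) (by positivity))
  have hT₂τ : T₂ ≤ τ := min_le_left _ _
  have hT₂σ : T₂ ≤ σ₀ / 2 := (min_le_right _ _).trans (min_le_left _ _)
  have hT₂K : T₂ * K ≤ 1 / 2 := by
    calc T₂ * K ≤ 1 / (2 * K + 1) * K :=
          mul_le_mul_of_nonneg_right ((min_le_right _ _).trans (min_le_right _ _)) hK0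
      _ ≤ 1 / 2 := by
          rw [div_mul_eq_mul_div, one_mul, div_le_iff₀ (by positivity)]
          linarith
  refine ⟨T₂, hT₂0, 2 * ((4 * Real.pi ^ 2)⁻¹ * L),
    fun {a u₁ u₂ w q} hu₁ hu₁div hu₂ hgev₁ hgev₂ hw hq hwdiv hzm hlin S => ?_⟩
  -- the window `[t₀, t₁]`, `t₁ = a + τ`, `t₀ = t₁ - T₂`, and the restricted data
  set t₁ : ℝ := a + τ with ht₁
  set t₀ : ℝ := a + τ - T₂ with ht₀
  have ht₀₁ : t₀ < t₁ := by rw [ht₀, ht₁]; linarith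
  have hlen : t₁ - t₀ = T₂ := by rw [ht₀, ht₁]; ring
  have hsub : Icc t₀ t₁ ⊆ Icc a (a + τ) := Icc_subset_Icc (by rw [ht₀]; linarith) le_rfl
  have hU : UniqueDiffOn ℝ (Icc t₀ t₁) := uniqueDiffOn_Icc ht₀₁
  have hu₁' : IsSmoothSpaceTimeOn (Icc t₀ t₁) u₁ := hu₁.mono hsub
  have hu₂' : IsSmoothSpaceTimeOn (Icc t₀ t₁) u₂ := hu₂.mono hsub
  have hw' : IsSmoothSpaceTimeOn (Icc t₀ t₁) w := hw.mono hsub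
  have hq' : IsSmoothSpaceTimeOn (Icc t₀ t₁) q := hq.mono hsub
  have hwdiv' : ∀ t ∈ Icc t₀ t₁, IsDivFree (w t) := fun t ht => hwdiv t (hsub ht)
  have hzm' : ∀ t ∈ Icc t₀ t₁, HasZeroMean (w t) := fun t ht => hzm t (hsub ht)
  have hlin' : ∀ t ∈ Icc t₀ t₁, ∀ x, timeDerivWithin (Icc t₀ t₁) w t x + Torus.convect (u₁ t) (w t) x +
      Torus.convect (w t) (u₂ t) x = ν • Torus.laplacian (w t) x - Torus.gradient (q t) x := by
    intro t ht x
    rw [hw.timeDerivWithin_eq_of_subset hsub hU ht x]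
    exact hlin t (hsub ht) x
  -- the backgrounds on the window: sup bounds and the weighted `ℓ¹` Gevrey bounds at radius `σ₀/2`
  have hBu₁ : ∀ t ∈ Icc a (a + τ), ∀ x, ‖u₁ t x‖ ≤ B := fun t ht =>
    (hB (u₁ t) (hu₁.isSmooth_slice ht) (hgev₁ t ht)).1
  have hBu₂ : ∀ i, ∀ t ∈ Icc a (a + τ), ∀ x, ‖partialDeriv i (u₂ t) x‖ ≤ B := fun i t ht =>
    (hB (u₂ t) (hu₂.isSmooth_slice ht) (hgev₂ t ht)).2.1 i
  have hgev₁' : ∀ t ∈ Icc t₀ t₁, (Summable fun m : d → ℤ => Real.exp (σ₀ / 2 * Real.sqrt (freqNormSq m)) *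
        ((1 + Real.sqrt (freqNormSq m)) * ‖mFourierCoeff (EuclideanSpace.complexify ∘ u₁ t) m‖)) ∧
      ∑' m : d → ℤ, Real.exp (σ₀ / 2 * Real.sqrt (freqNormSq m)) *
        ((1 + Real.sqrt (freqNormSq m)) * ‖mFourierCoeff (EuclideanSpace.complexify ∘ u₁ t) m‖) ≤ A :=
    fun t ht => summable_exp_mul_one_add_sqrt_mul_norm_of_gevreyBound hσ₀ (hgev₁ t (hsub ht))
  have hgev₂' : ∀ t ∈ Icc t₀ t₁, (Summable fun m : d → ℤ => Real.exp (σ₀ / 2 * Real.sqrt (freqNormSq m)) *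
        ((1 + Real.sqrt (freqNormSq m)) * ‖mFourierCoeff (EuclideanSpace.complexify ∘ u₂ t) m‖)) ∧
      ∑' m : d → ℤ, Real.exp (σ₀ / 2 * Real.sqrt (freqNormSq m)) *
        ((1 + Real.sqrt (freqNormSq m)) * ‖mFourierCoeff (EuclideanSpace.complexify ∘ u₂ t) m‖) ≤ A :=
    fun t ht => summable_exp_mul_one_add_sqrt_mul_norm_of_gevreyBound hσ₀ (hgev₂ t (hsub ht))
  -- the exponential `H¹` bound: `‖∇w(r)‖₂² ≤ H₀ L` on the window
  set H₀ : ℝ := (∫ x, ‖w a x‖ ^ 2) + gradNormSq (w a) with hH₀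
  have hH₀0 : 0 ≤ H₀ := add_nonneg (integral_nonneg fun x => sq_nonneg _) (gradNormSq_nonneg _)
  have hGH : ∀ r ∈ Icc t₀ t₁, gradNormSq (w r) ≤ H₀ * L := by
    intro r hr
    have hr' : r ∈ Icc a (a + τ) := hsub hr
    have h := Torus.twoBackground_h1_le_mul_exp hν hu₁ hu₁div hu₂ hw hq hwdiv hlin (M := B) hBu₁
      (C := fun _ => B) hBu₂ hr'
    refine (le_add_of_nonneg_left (integral_nonneg fun x => sq_nonneg _)).trans
      (h.trans (mul_le_mul_of_nonneg_left (Real.exp_le_exp.2 ?_) hH₀0))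
    have h1 : 0 ≤ r - a := sub_nonneg.2 hr'.1
    have h2 : r - a ≤ τ := by linarith [hr'.2]
    calc K' * (r - a) ≤ max K' 0 * (r - a) := mul_le_mul_of_nonneg_right (le_max_left _ _) h1
      _ ≤ max K' 0 * τ := mul_le_mul_of_nonneg_left h2 (le_max_right _ _)
  -- the truncation parameter: `S` inside the ball of radius `N`
  set N : ℝ := (∑ k ∈ S, freqNormSq k) + 1 with hN
  have hN0 : 0 ≤ N := by
    have : 0 ≤ ∑ k ∈ S, freqNormSq k := Finset.sum_nonneg fun k _ => freqNormSq_nonneg k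
    linarith
  have hSN : ∀ k ∈ S, Real.sqrt (freqNormSq k) ≤ N := by
    intro k hk
    have h1 : freqNormSq k ≤ ∑ j ∈ S, freqNormSq j :=
      Finset.single_le_sum (f := fun j => freqNormSq j) (fun j _ => freqNormSq_nonneg j) hk
    have h2 : Real.sqrt (freqNormSq k) ≤ freqNormSq k + 1 := by
      rw [Real.sqrt_le_left (by linarith [freqNormSq_nonneg k])]
      nlinarith [freqNormSq_nonneg k]
    linarith
  -- the truncated Gevrey sums of `w` and the linear balance
  set Y : ℝ → ℝ := fun r => ∑' k, Real.exp ((r - t₀) * min (Real.sqrt (freqNormSq k)) N) ^ 2 *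
    (freqNormSq k * ‖mFourierCoeff (EuclideanSpace.complexify ∘ w r) k‖ ^ 2) with hY
  set Z : ℝ → ℝ := fun r => ∑' k, Real.exp ((r - t₀) * min (Real.sqrt (freqNormSq k)) N) ^ 2 *
    (freqNormSq k ^ 2 * ‖mFourierCoeff (EuclideanSpace.complexify ∘ w r) k‖ ^ 2) with hZ
  set ZR : ℕ → ℝ → ℝ := fun R r => ∑ k ∈ freqBall R, Real.exp ((r - t₀) * min (Real.sqrt (freqNormSq k)) N) ^ 2 *
    (freqNormSq k ^ 2 * ‖mFourierCoeff (EuclideanSpace.complexify ∘ w r) k‖ ^ 2) with hZR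
  set DR : ℕ → ℝ → ℝ := fun R r => ∑ k ∈ freqBall R, (2 * min (Real.sqrt (freqNormSq k)) N *
      Real.exp ((r - t₀) * min (Real.sqrt (freqNormSq k)) N) ^ 2 *
        (freqNormSq k * ‖mFourierCoeff (EuclideanSpace.complexify ∘ w r) k‖ ^ 2) +
    Real.exp ((r - t₀) * min (Real.sqrt (freqNormSq k)) N) ^ 2 * (freqNormSq k *
      (2 * (inner ℂ (mFourierCoeff (EuclideanSpace.complexify ∘ timeDerivWithin (Icc t₀ t₁) w r) k)
        (mFourierCoeff (EuclideanSpace.complexify ∘ w r) k)).re))) with hDR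
  have hZ0 : ∀ r, 0 ≤ Z r := fun r => tsum_nonneg fun k => by positivity
  have hbal : ∀ R : ℕ, ∀ r ∈ Icc t₀ t₁, DR R r ≤ -(5 / 4 * (4 * Real.pi ^ 2 * ν)) * ZR R r + K * Y r :=
    fun R r hr => Torus.twoBackground_gevreyBalance_le hν hu₁' hu₂' hw' hq' hwdiv' hzm' hlin' (σ := σ₀ / 2)
      (by rw [hlen]; exact hT₂σ) hgev₁' hgev₂' R hN0 hr
  have hlev : ∀ {M : ℝ} (R : ℕ), ∀ r ∈ Icc t₀ t₁, Y r ≤ M →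
      DR R r ≤ -(5 / 4 * (4 * Real.pi ^ 2 * ν)) * ZR R r + (4 * Real.pi ^ 2 * ν) / 4 * Z r + K * M := by
    intro M R r hr hYM
    have h1 := hbal R r hr
    have h2 : K * Y r ≤ K * M := mul_le_mul_of_nonneg_left hYM hK0
    have h3 : 0 ≤ (4 * Real.pi ^ 2 * ν) / 4 * Z r := mul_nonneg (by positivity) (hZ0 r)
    linarith
  -- `y₀`, the a-priori level and the bootstrap at the levels `2 y₀ + ε`
  set y₀ : ℝ := (4 * Real.pi ^ 2)⁻¹ * (H₀ * L) with hy₀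
  have hy₀0 : 0 ≤ y₀ := by positivity
  set Λ' : ℝ := Real.exp ((t₁ - t₀) * N) ^ 2 * y₀ with hΛ'
  have hΛ'0 : 0 ≤ Λ' := by positivity
  have hap : ∀ r ∈ Icc t₀ t₁, Y r ≤ Λ' := fun r hr =>
    (summable_exp_sq_mul_freqNormSq_mul hw' hN0 hr).2.trans (by
      rw [hΛ', hy₀, mul_assoc]
      exact mul_le_mul_of_nonneg_left (mul_le_mul_of_nonneg_left (hGH r hr) (by positivity)) (sq_nonneg _))
  have hYt₀ : Y t₀ ≤ y₀ := by
    have h1 := (summable_weight_mul_freqNormSq_mul (hw'.isSmooth_slice ⟨le_rfl, ht₀₁.le⟩)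
      (w := fun k => Real.exp ((t₀ - t₀) * min (Real.sqrt (freqNormSq k)) N) ^ 2) (W := 1)
      (fun _ => sq_nonneg _) (fun k => by rw [sub_self, zero_mul, Real.exp_zero, one_pow])).2
    refine h1.trans ?_
    rw [one_mul, hy₀]
    exact mul_le_mul_of_nonneg_left (hGH t₀ ⟨le_rfl, ht₀₁.le⟩) (by positivity)
  have hYε : ∀ ε : ℝ, 0 < ε → Y t₁ ≤ 2 * y₀ + ε := by
    intro ε hε
    have hM0 : 0 ≤ 2 * y₀ + ε := by positivity
    refine le_of_two_level_bound (y := Y) (y₀ := Y t₀) (M := 2 * y₀ + ε) (mul_nonneg hK0 hM0)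
      (mul_nonneg hK0 hΛ'0) ?_ (fun s t hs hst ht hMs => ?_) t₁ ⟨ht₀₁.le, le_rfl⟩
    · rw [hlen]
      have h1 : T₂ * (K * (2 * y₀ + ε)) ≤ 1 / 2 * (2 * y₀ + ε) := by
        rw [← mul_assoc]
        exact mul_le_mul_of_nonneg_right hT₂K hM0
      linarith
    · exact gevrey_two_level_of_balance hw' ht₀₁ hN0 (by positivity : (0 : ℝ) ≤ 4 * Real.pi ^ 2 * ν)
        (fun r => rfl) (fun r => rfl) (fun R r => rfl) (fun R r => rfl) (fun R r => rfl)
        (fun R r hr hYr => hlev R r hr hYr) (fun R r hr hYr => hlev R r hr hYr) hap hs hst ht hMs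
  have hfin : Y t₁ ≤ 2 * y₀ := le_of_forall_pos_le_add fun ε hε => hYε ε hε
  -- at the final time, on the finite set `S`, the truncated weights are the full Gevrey weights
  have hsumm := (summable_exp_sq_mul_freqNormSq_mul hw' hN0 ⟨ht₀₁.le, le_rfl⟩).1
  have hwt₁ : IsSmooth (w t₁) := hw'.isSmooth_slice ⟨ht₀₁.le, le_rfl⟩
  have hCy : 2 * ((4 * Real.pi ^ 2)⁻¹ * L) * H₀ = 2 * y₀ := by rw [hy₀]; ring
  rw [hCy]
  refine le_trans ?_ ((hsumm.sum_le_tsum S fun k _ => mul_nonneg (sq_nonneg _)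
    (mul_nonneg (freqNormSq_nonneg k) (sq_nonneg _))).trans hfin)
  refine Finset.sum_le_sum fun k hk => ?_
  rw [min_eq_left (hSN k hk), hlen, ← Real.exp_nat_mul, Nat.cast_ofNat,
    show 2 * (T₂ * Real.sqrt (freqNormSq k)) = 2 * T₂ * Real.sqrt (freqNormSq k) by ring]
  by_cases hk0 : k = 0
  · rw [hk0, mFourierCoeff_complexify_zero_of_hasZeroMean hwt₁.integrable (hzm' t₁ ⟨ht₀₁.le, le_rfl⟩)]
    simp
  · have h1 : 1 ≤ freqNormSq k := one_le_freqNormSq_of_ne_zero hk0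
    have hw0 : 0 ≤ Real.exp (2 * T₂ * Real.sqrt (freqNormSq k)) *
        ‖mFourierCoeff (EuclideanSpace.complexify ∘ w t₁) k‖ ^ 2 := by positivity
    calc Real.exp (2 * T₂ * Real.sqrt (freqNormSq k)) * ‖mFourierCoeff (EuclideanSpace.complexify ∘ w t₁) k‖ ^ 2
        = 1 * (Real.exp (2 * T₂ * Real.sqrt (freqNormSq k)) *
            ‖mFourierCoeff (EuclideanSpace.complexify ∘ w t₁) k‖ ^ 2) := (one_mul _).symm
      _ ≤ freqNormSq k * (Real.exp (2 * T₂ * Real.sqrt (freqNormSq k)) *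
            ‖mFourierCoeff (EuclideanSpace.complexify ∘ w t₁) k‖ ^ 2) := mul_le_mul_of_nonneg_right h1 hw0
      _ = _ := by ring

end NSGevrey

end Literature.Analysis.FluidPDE
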